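import Summits.Parity.BatemanHorn.Theses.SelbergDelangeRigidity
import Summits.Parity.BatemanHorn.Theorems.LSDRealSegment.Negative.Structure
import Summits.Parity.BatemanHorn.Theorems.LSDRealSegment.Negative.NoSpikes
import Summits.Parity.BatemanHorn.Theorems.SelbergDelangeRigidityDefsRows
import Summits.Parity.BatemanHorn.Theorems.SelbergDelangeRigidityLSDRealSegmentConclusionLow
import Summits.Parity.BatemanHorn.Theorems.SelbergDelangeRigidityLSDRealSegmentTailsTwoPrinted

/-!
# Line `product-anatomy-subcritical` — checked skeleton for crux `LSDRealSegment`, rev L4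
(item stmt-Parity-9770, route `SelbergDelangeRigidity`, sub-problem `BatemanHorn`; lead prover-line-stmt-Parity-9770-0 rev L1–L3,
continuation lead prover-line-stmt-Parity-9770-c1-0 rev L4, 2026-08-16)

Crux (by name, concluded by `LSDRealSegment_of` below, fed by `lsdRealSegment_of_parts`):
`Summit.Parity.BatemanHorn.Theses.SelbergDelangeRigidity.LSDRealSegment`.

## State of the line (everything cited is ACCEPTED in the tree; namespace of this file)

* VOCABULARY: `Theorems/SelbergDelangeRigidityDefs.lean` (p85748) and the REPAIRED rows predicate `CheapRowsUnit`
  (`…DefsRows.lean`, p106115: `CheapRows` + `η₀ ≤ 1`, after `stub_cheapRows_false` p103293 refuted the rev-L1 typing).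
* `stub_eulerFactor` LANDED (p88558; aux p86582 uniform `ρ_F(p^a) ≤ C`).  `stub_typeI` LANDED (p91889; `typeI_local` p89551,
  `typeI_sandwich` p91067, `typeI_levinFainleib` p91345 = the general Levin–Faĭnleĭb theorem).
* TOTAL DEGREE ≤ 1 (the systems `∅` and one linear form `aX+b`) is COMPLETELY CLOSED: tails `tails_of_sum_natDegree_le_one`
  (p94723), rows `cheapRowsUnit_of_sum_natDegree_le_one` (p104184/p106115), kernel law `kernelLaw_of_sum_natDegree_le_one`
  (p107026), and the crux's conclusion itself `lsdRealSegment_of_sum_natDegree_le_one` (p111579: `Conclusion k f` for every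
  Bateman–Horn system of total degree `≤ 1`, `Λ = λ_F`).
* TOTAL DEGREE = 2 (one irreducible quadratic; a linear pair): the four tails are landed CONDITIONALLY on ONE faithful named
  fact, the PRINTED Nair–Tenenbaum Theorem 1 `Literature.NumberTheory.Sieve.NairTenenbaum1998_theorem1_printed` (p127234;
  `stub_tailsTwo_of_NT_printed`, p130300, files `…TailsTwoPrinted{EngineAux,Engine}`, `…TailsTwo{APriori,Rankin,Top,BalQ}OfEngine`,
  `…TailsTwoPrinted`) — rev L4: the rev-L3 form `stub_tailsTwo_of_facts` (p122105) rested on the MISSTATED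
  `NairTenenbaum1998_theorem1` (Erratum 2 of `NairTenenbaumShortSums.lean`: Henriot's range `α < 1` over-claims; the chain only
  uses `α = 1/4 < 1/2`, covered by print) and on `BugeaudEvertseGyory2018_SPartPolynomialValues`, which is now PROVED in the tree
  (`…_holds`, `Literature/…/RidoutIntegers.lean`) and has been discharged (`stub_tailsTwo_of_NT`, p127368); every SUB-LEVEL row is landed (`cheapRows_subLevel`, p97603); the reconstruction framework
  is landed (`reconstruction_bookkeeping`, `sum_tilt_le_of_holder`, p111571) with the audit verdict "rows with θ ≥ 1 are needed and
  the typed family is sufficient" (work/stubs/StubReconstructionAudit.md).  OPEN: the beyond-level rows (`stub_cheapRowsTwo`), the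
  drop-the-max assembly (`stub_reconstructionTwo`, XL), and the unconditional tails (`stub_tailsTwo` = the ONE named fact
  `NairTenenbaum1998_theorem1_printed`, i.e. a proof of Nair–Tenenbaum's Theorem 1).
* TOTAL DEGREE ≥ 3: `stub_kernelHigh` (the lead's; open-problem, crux-sized: the crux for these members minus the Type-I theorem).
Registered stubs (rev L4 = rev L3, unchanged signatures): `stub_tailsTwo`, `stub_cheapRowsTwo`, `stub_reconstructionTwo`,
`stub_kernelHigh` — all four speak about total degree `= 2` or `≥ 3` only.  `lean check`: `sorry` exactly in these four;
`LSDRealSegment_of : LSDRealSegment` by name.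
Closed modulo: {NT printed} (tails) + beyond-level rows + reconstruction assembly (degree 2) + `stub_kernelHigh` (degree ≥ 3).
-/

open Filter Finset Polynomial
open scoped BigOperators Topology Classical

namespace Summit.Parity.BatemanHorn.Cruxes.LSDRealSegment.ProductAnatomySubcritical

open Literature.NumberTheory.Sieve
open ArithmeticFunction (cardFactors)
open Summit.Parity.BatemanHorn.Theses.SelbergDelangeRigidity (LSDRealSegment)

noncomputable section

/-! ### The registered stubs (rev L4; signatures as registered in rev L3) -/

/-- **stub_tailsTwo** (rev L2 of `stub_tails`, restricted to total degree EXACTLY `2` — the only degrees the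
composition consumes beyond the landed `tails_of_sum_natDegree_le_one`).  STATUS rev L4: CLOSED MODULO ONE NAMED FACT —
`stub_tailsTwo_of_NT_printed : NairTenenbaum1998_theorem1_printed → (this statement)` is landed (p130300); the `p`-adic
Roth input is PROVED in the tree and discharged.  Members: ONE IRREDUCIBLE QUADRATIC `g`
(needs Nair–Tenenbaum 1998 Thm 1 AS PRINTED, `Literature.NumberTheory.Sieve.NairTenenbaum1998_theorem1_printed`, applied at
`α = 1/4` to the PEELED weight on the rescaled systems, and, for members with a `p`-adic root at a prime `p < y²`
(e.g. `X² + 7` at `p = 2`), the `p`-adic Roth input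
`Literature.NumberTheory.DiophantineApproximation.BugeaudEvertseGyory2018_SPartPolynomialValues` — PROVED (`…_holds`),
forced by `Negative.NoSpikes`); A LINEAR PAIR `(a₁X+b₁, a₂X+b₂)` (class-`M` bounds for two linear forms are Shiu-type — tree
`Literature/NumberTheory/Sieve/PairShiu*`; no Roth input: `p^ν ∣ aᵢn+bᵢ ≤ aᵢx+bᵢ`).  Proof dictionary as in rev L1
(`stub_tails` docstring of `Lines/product_anatomy_subcritical.lean`): (a) order of magnitude by (NT) on the peeled weight
+ prime powers `p^ν ≤ x^{1−ε}` by complete periods (`Σ(y/p)^ν < ∞`, `y < 2`) + Hölder on `(x^{1−ε}, Cx^{1+ε'}]` + (R) above;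
(b) Rankin `1[a_θ(n) > x^τ] ≤ (a_θ(n)/x^τ)^σ`, `σ = 1/(θ log x)` (`tails_smoothTilt_sum_le` is the integer model);
(c) `fᵢ(n) = m p`, `m ≤ A x^η`, dimension-1 upper-bound sieve per `m` with spectator tilt: `≪ η^y x (log x)^{k(y−1)}`;
(d) `m p q` / `m₁p, m₂q`, dimension-2: `≪ δ^y`, `δ^{2y}`. -/
theorem stub_tailsTwo :
    ∀ (k : ℕ) (f : Fin k → ℤ[X]), IsBatemanHornSystem f → (∑ i, (f i).natDegree) = 2 → ∀ y : ℝ, 1 ≤ y → y < 2 →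
      APrioriBound k f y ∧ RankinTail k f y ∧ TopClassBound k f y ∧ BalancedClassBound k f y := by
  sorry

/-- **stub_cheapRowsTwo** (rev L3 of `stub_cheapRows`: REPAIRED predicate `CheapRowsUnit`, and total degree EXACTLY `2` — degree `≤ 1` is
landed, `cheapRowsUnit_of_sum_natDegree_le_one`; the unrepaired one is
refuted, `stub_cheapRows_false`) — THE OPEN INPUT of the line (in scope `Σ deg fᵢ ≤ 2`).  PROVED so far: every family of
total degree `≤ 1` (`cheapRowsUnit_of_sum_natDegree_le_one`) and every SUB-LEVEL row `η' + Σⱼβⱼ < 1` of every family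
(`cheapRows_subLevel`, p97603); OPEN: the beyond-level rows `θ = η' + Σⱼβⱼ ≥ 1` of the quadratic member (`θ` up to
`2 − η₀/2`; minimal open row: two balanced primes in `(x^{1/2}, x^{1/2+δ}]`, signed root equidistribution to moduli
`p₁p₂ ∈ (x, x^{1+2δ}]` on `[1, x]`) and of the linear pair (`1 ≤ θ ≤ 3/2`; DFI 1997 in tree ⇒ `θ < 96/95` derivable,
long; beyond = `GaussianFractions.RootFractionsBound` strength) — diagnosis in `…CheapRows.lean` (p104184).  Rev-L1 text:  Members: `k = 0` and `s = 0` rows are complete-period identities (TRUE, provable: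
`|#{n ≤ x : e ∣ F(n)} − xρ_F(e)/e| ≤ ρ_F(e) ≤ x^{η'}ρ_F(e)/e`); a single linear `f`: totals `≤ 1 − η₀`, Type I
(TRUE, provable: floor errors `≤ #tuples ≤ x^{1−η₀} = o(main)`); ONE QUADRATIC `g`: roots of `g` modulo
`e·p₁⋯p_s ≤ x^{2−η₀/2}`, all `pⱼ ≤ x^{1−η₀}`, counted in `[1, x]` — positive main-term equidistribution for SMOOTH
moduli beyond level `x` (in print: `θ = 1` Hooley/DFI–Tóth `dukeFriedlanderIwaniecToth_quadraticRoots_primeModuli`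
(fixed scale), `θ = 1 + δ` with well-factorable weights de la Bretèche–Drappeau JEMS 2020 doi:10.4171/jems/951 —
modulus class to confirm, triage r1-2 (c); beyond: square-root cancellation in `r`-linear root-twisted Kloosterman
fractions, `r ≥ θ/(2−θ)`, the shared open input of `GaussianFractions.RootFractionsBound` at `θ = 1 ± δ`);
LINEAR PAIR `(a₁X+b₁, a₂X+b₂)`: CRT points `−Δ·\bar{d₁}/d₂`, `Δ = a₁b₂ − a₂b₁ ≠ 0` (= `pairwise_not_associated`),
constant numerators: regimes (A) BV-for-convolutions, (B) characters × large sieve, (C) balanced bilinear Kloosterman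
fractions — the first rung beyond level 1 is a COROLLARY of the in-tree PROVED fact
`Literature.NumberTheory.LFunctions.DukeFriedlanderIwaniec1997_bilinearKloostermanFractions` (`θ < 96/95` balanced,
`< 107/106` all admissible shapes; triage r1-3 N3), DFI's conjecture `(M+N)^{1/2}` is worth `θ = 4/3`
(card twin-three-regime-map).  Why it is NOT the crux in costume: a family of POSITIVE equidistribution statements for
FACTORABLE moduli at SUB-CRITICAL scale (`x ≥ (modulus)^{1/2 + η₀/4}`), no prime detected in `n` or in the modulus,
no signs, no `y`, no `Λ`; strictly weaker than the card's W_F (prime-moduli rows, a `γ = 1 − 1/θ < 1/2`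
prime-detection problem after Hooley's switch, are never asked — triage r1-3 (ii)); it prices the crux monotonically:
rows up to total `θ` buy the configuration law up to the LP width `w_θ(y) ↓ 0` (`θ → 2`).  Honest residuals: for the
quadratic member the numerators are ROOT-ENTANGLED (GaussianFractions' rank-2 difficulty); the endpoint (all `η₀`) is
DFI-optimal strength, uniformly in `s ≤ 2/α`.  `Literature.Barriers.Parity.FordFixedLevelBarrier` is conceded: every
`η₀ > 0` is needed. -/
theorem stub_cheapRowsTwo :
    ∀ (k : ℕ) (f : Fin k → ℤ[X]), IsBatemanHornSystem f → (∑ i, (f i).natDegree) = 2 → CheapRowsUnit k f := by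
  sorry

/-- **stub_reconstructionTwo** (rev L3: hypothesis `CheapRowsUnit` (margins `η₀ ≤ 1`), total degree EXACTLY `2` — the
degree-`≤ 1` kernel law is LANDED, `kernelLaw_of_sum_natDegree_le_one` p107026; framework `reconstruction_bookkeeping` /
`sum_tilt_le_of_holder` landed p111571; audit: the typed rows are sufficient, work/stubs/StubReconstructionAudit.md) — THE LINE'S CONDITIONAL THEOREM (size XL; provable in principle, no arithmetic input
beyond its hypotheses + Mertens for `ρ_F`).  For `Σ deg ≤ 2` the Bateman–Horn systems are `∅` (kernel `= 0`,
constant `1·(1·1 − Γ(1)⁻¹) = 0`), one linear `aX+b` (divisors `d > x` of a value `≤ ax+b` have co-divisor `≤ a`: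
`K_x ≤ (a+1)Σ_{m ≤ ax+b} g_y(m) ≪ x(log x)^{y−2} = o(x(log x)^{y−1})`, constant `λ(1⁰Γ(y)⁻¹ − Γ(y)⁻¹) = 0` ✓),
one quadratic, a linear pair.  General scheme, parameters `ε ≪ η' ≪ η₀`, `η, δ ≥ η₀`, mesh `≪ εη₀`:
(0) `n ≤ x^{1−ε''}` and `n < n₀` by `APrioriBound`; (1) write `P(n) = a·b`, `a` the `x^ε`-smooth part, `b` squarefree
off a class of density `Σ_{p>x^ε}ρ(p²)x/p² → 0` (bounded tilt), configuration `c(n) = {log p/log x : p ∣ b}` assigned to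
factors (`p ∤ Res` eventually), per-factor totals `dᵢ·log n/log x − O(η')`; (2) discard the thin classes:
`TopClassBound` (`max cᵢ > dᵢ − η`), `BalancedClassBound` (two parts `> 1 − δ`), `RankinTail` at `(θ,τ) = (ε, η')`
(`a > x^{η'}`) and at `(η₀, 1/2)` (`P(n)` nearly `x^{η₀}`-smooth, i.e. `max cᵢ < η₀`) — each `≤ ε₁ x(log x)^κ`;
(3) on the main class `Σ_{d ∣ P(n), d > x} g_y(d) = Σ_{e ∣ a} g_y(e) Φ_y(c(n); 1 − log e/log x)`,
`Φ_y(c; t) = Σ_{S ⊆ c, ΣS > t}(y−1)^{|S|}`, and `Σ_n g_y(e)1[e ∣ P(n)]N_π(c(n))` is a twisted cheap row: the shapes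
`π = c ∖ max` (max of each factor dropped) have parts `≤ second ≤ 1 − δ`, per-factor totals `dᵢ − max ≤ dᵢ − η₀` and
`max π + |π| ≤ dᵢ` (the `+η₀` of `CheapRows` absorbs the mesh), and `c ↦ c ∖ max` is INJECTIVE given the pinned totals
with a unitriangular sub-multiset matrix (triage r1-2/r1-3: ghost dimension 0 for `(2,)` and `(1,1)`), so along any
subsequence the limiting twisted configuration law (tight: `≤ 2/ε` parts) is DETERMINED and equals the model's —
`x·ρ_F(e)/e ×` [independent PD(1) point processes per factor on scale `dᵢ`, intensity `du/u`] — by `CheapRows`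
(uniformly in `e ≤ x^{η'}`; asymptotic independence of `e ∣ F(n)` from the large configuration is part of what the rows
say); `Φ_y` is bounded and continuous off a model-null set, so expectations converge (portmanteau); (4) CALIBRATION:
`Σ_{e x^ε-smooth} g_y(e)ρ_F(e)/e = ∏_{p ≤ x^ε} E_p(y) ~ λ_F(y)(e^γ ε log x)^{k(y−1)}` (Mertens for `ρ_F`:
`Literature.NumberTheory.LFunctions.Mertens.*` + Landau for roots; `stub_eulerFactor`'s product) and the tilted Ewens
constant of PD(1) above level `ε/dᵢ` is `(ε/dᵢ)^{1−y}e^{−γ(y−1)}/Γ(y)·(1 + o(1))` per factor, whence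
`M_x ~ λ_F(y) D^{y−1}Γ(y)^{−k} x(log x)^{k(y−1)}` (`ε`, `e^{±γ}` cancel identically) and `K_x = M_x − T_x` with
`TypeILawOmega` gives the stated constant; (5) real → complex.  Where `pairwise_not_associated` enters: independence
of the `k` processes (distinct primes off the resultant); for `(X, X)` the limit exists with the `y²`-Ewens constant
(`Negative.LoadBearing.lsdRealSegment_false_without_pairwise_not_associated`). -/
theorem stub_reconstructionTwo :
    ∀ (k : ℕ) (f : Fin k → ℤ[X]), IsBatemanHornSystem f → (∑ i, (f i).natDegree) = 2 →
      (∀ y : ℝ, 1 < y → y < 2 → TypeILawOmega k f y) → CheapRowsUnit k f →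
      (∀ y : ℝ, 1 ≤ y → y < 2 →
        APrioriBound k f y ∧ RankinTail k f y ∧ TopClassBound k f y ∧ BalancedClassBound k f y) →
      ∀ y : ℝ, 5 / 4 < y → y < 7 / 4 → KernelLawOmega k f y := by
  sorry

/-- **stub_kernelHigh** — OPEN ANNEX (`Σ deg fᵢ ≥ 3`: one cubic, `(X, X²+1)`, three linear forms, …).  By
`typeISum_add_kernelSum` and `stub_typeI` it is EQUIVALENT to the crux's conclusion for these members with `Λ = λ_F`
(forced anyway: `Negative.Structure.omegaLaw_Λ_unique`).  NOT claimed attackable by this line: the drop-the-max identity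
queries, for `T = 3`, PRIME rows at `a ∈ (1, T/2]` (after the switch a prime count in the quotient family, Chebyshev–Hooley
densities, open as asymptotics already at `a = 1 + δ`) AND smooth rows of total `∈ (2, T − η)` (beyond square root), triage
r1-3 N1; `Λ(y)` carries averaged Hardy–Littlewood/`P₂` content here (Disproof §8(b)); from degree 4/5 on the un-capping also
hides square-free / cube-free values of `fᵢ` at large primes (r1-3 N2).  Filed as ONE stub so that the tenure planner's recommended
split of `LSDRealSegment` by total degree has a named target; conditional annex available: `RootMH(F)` (card
montgomery-rows-all-degrees, rows `θ₂ ≤ deg/2`) ⇒ this law, à la G. Martin, JNT 2002 (arXiv:math/9909180). -/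
theorem stub_kernelHigh :
    ∀ (k : ℕ) (f : Fin k → ℤ[X]), IsBatemanHornSystem f → 3 ≤ (∑ i, (f i).natDegree) →
      ∀ y : ℝ, 5 / 4 < y → y < 7 / 4 → KernelLawOmega k f y := by
  sorry

/-! ### Glue (PROVED) and the composition -/

/-- `EulerFactorClause` from the LANDED holomorphy stub and the PROVED pin. -/
theorem eulerFactorClause_holds {k : ℕ} {f : Fin k → ℤ[X]} (hf : IsBatemanHornSystem f) : EulerFactorClause k f :=
  ⟨stub_eulerFactor k f hf, eulerFactor_zero hf⟩

/-- The tails of total degree `2`, modulo the ONE named fact `NairTenenbaum1998_theorem1_printed` (Nair–Tenenbaum 1998,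
Theorem 1 as printed): this is the LANDED `stub_tailsTwo_of_NT_printed` (p130300, rev L4), recorded here to show exactly what
`stub_tailsTwo` is open modulo (rev L3 needed two facts, one of them misstated). -/
theorem tailsTwo_of_NT_printed (hNT : NairTenenbaum1998_theorem1_printed) :
    ∀ (k : ℕ) (f : Fin k → ℤ[X]), IsBatemanHornSystem f → (∑ i, (f i).natDegree) = 2 → ∀ y : ℝ, 1 ≤ y → y < 2 →
      APrioriBound k f y ∧ RankinTail k f y ∧ TopClassBound k f y ∧ BalancedClassBound k f y :=
  stub_tailsTwo_of_NT_printed hNT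

/-- **Segment law from the two halves** at the EXPLICIT `Λ = eulerFactor f` (limits add; constants by `ring`). -/
theorem segmentLaw_of_halves {k : ℕ} {f : Fin k → ℤ[X]} {y : ℝ}
    (hT : TypeILawOmega k f y) (hK : KernelLawOmega k f y) :
    Tendsto (fun x : ℕ => (x : ℂ)⁻¹ * Complex.exp ((k : ℂ) * (1 - (y : ℂ)) * (Real.log (Real.log x) : ℂ)) *
        ∑ n ∈ Finset.range (x + 1), (y : ℂ) ^ (∑ i, cardFactors (((f i).eval (n : ℤ)).toNat))) atTop
      (𝓝 (eulerFactor f y * Complex.exp (((y : ℂ) - 1) * (Real.log (∏ i, ((f i).natDegree : ℝ)) : ℂ)) *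
        (Complex.Gamma y)⁻¹ ^ k)) := by
  have h3 := (hT.add hK).congr fun x => (normSum_eq_typeI_add_kernel f y x).symm
  convert h3 using 2
  ring

/-- **The kernel law for every Bateman–Horn system from the stubs' STATEMENTS** (split by total degree: `≤ 1` is the LANDED
`kernelLaw_of_sum_natDegree_le_one`; `= 2` is the reconstruction from Type-I (landed), rows and tails; `≥ 3` the annex). -/
theorem kernelLaw_of_parts
    (hT2 : ∀ (k : ℕ) (f : Fin k → ℤ[X]), IsBatemanHornSystem f → (∑ i, (f i).natDegree) = 2 → ∀ y : ℝ, 1 ≤ y → y < 2 →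
      APrioriBound k f y ∧ RankinTail k f y ∧ TopClassBound k f y ∧ BalancedClassBound k f y)
    (hRows : ∀ (k : ℕ) (f : Fin k → ℤ[X]), IsBatemanHornSystem f → (∑ i, (f i).natDegree) = 2 → CheapRowsUnit k f)
    (hRec : ∀ (k : ℕ) (f : Fin k → ℤ[X]), IsBatemanHornSystem f → (∑ i, (f i).natDegree) = 2 →
      (∀ y : ℝ, 1 < y → y < 2 → TypeILawOmega k f y) → CheapRowsUnit k f →
      (∀ y : ℝ, 1 ≤ y → y < 2 →
        APrioriBound k f y ∧ RankinTail k f y ∧ TopClassBound k f y ∧ BalancedClassBound k f y) →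
      ∀ y : ℝ, 5 / 4 < y → y < 7 / 4 → KernelLawOmega k f y)
    (hHigh : ∀ (k : ℕ) (f : Fin k → ℤ[X]), IsBatemanHornSystem f → 3 ≤ (∑ i, (f i).natDegree) →
      ∀ y : ℝ, 5 / 4 < y → y < 7 / 4 → KernelLawOmega k f y)
    {k : ℕ} {f : Fin k → ℤ[X]} (hf : IsBatemanHornSystem f) {y : ℝ} (hy : 5 / 4 < y) (hy' : y < 7 / 4) :
    KernelLawOmega k f y := by
  rcases Nat.lt_trichotomy (∑ i, (f i).natDegree) 2 with h | h | h
  · exact kernelLaw_of_sum_natDegree_le_one k f hf (by omega) y (by linarith) (by linarith)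
  · exact hRec k f hf h (stub_typeI k f hf) (hRows k f hf h) (hT2 k f hf h) y hy hy'
  · exact hHigh k f hf (by omega) y hy hy'

/-- **Composition, hypothesis form** (real proof, standard axioms): the four stub STATEMENTS (plus the landed theorems)
imply the crux's body verbatim, with `Λ := eulerFactor f`. (Stated with the body, not the name, so that exactly one
theorem of this file — `LSDRealSegment_of` — concludes `LSDRealSegment` by name.) -/
theorem lsdRealSegment_of_parts
    (hT2 : ∀ (k : ℕ) (f : Fin k → ℤ[X]), IsBatemanHornSystem f → (∑ i, (f i).natDegree) = 2 → ∀ y : ℝ, 1 ≤ y → y < 2 →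
      APrioriBound k f y ∧ RankinTail k f y ∧ TopClassBound k f y ∧ BalancedClassBound k f y)
    (hRows : ∀ (k : ℕ) (f : Fin k → ℤ[X]), IsBatemanHornSystem f → (∑ i, (f i).natDegree) = 2 → CheapRowsUnit k f)
    (hRec : ∀ (k : ℕ) (f : Fin k → ℤ[X]), IsBatemanHornSystem f → (∑ i, (f i).natDegree) = 2 →
      (∀ y : ℝ, 1 < y → y < 2 → TypeILawOmega k f y) → CheapRowsUnit k f →
      (∀ y : ℝ, 1 ≤ y → y < 2 →
        APrioriBound k f y ∧ RankinTail k f y ∧ TopClassBound k f y ∧ BalancedClassBound k f y) →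
      ∀ y : ℝ, 5 / 4 < y → y < 7 / 4 → KernelLawOmega k f y)
    (hHigh : ∀ (k : ℕ) (f : Fin k → ℤ[X]), IsBatemanHornSystem f → 3 ≤ (∑ i, (f i).natDegree) →
      ∀ y : ℝ, 5 / 4 < y → y < 7 / 4 → KernelLawOmega k f y) :
    ∀ (k : ℕ) (f : Fin k → Polynomial ℤ), Literature.NumberTheory.Sieve.IsBatemanHornSystem f →
      ∃ Λ : ℂ → ℂ, DifferentiableOn ℂ Λ (Metric.ball 0 2) ∧
        Λ 0 = (Literature.NumberTheory.Sieve.batemanHornConst f : ℂ) ∧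
        ∀ y : ℝ, 5 / 4 < y → y < 7 / 4 → Filter.Tendsto (fun x : ℕ => (x : ℂ)⁻¹ *
          Complex.exp ((k : ℂ) * (1 - (y : ℂ)) * (Real.log (Real.log x) : ℂ)) *
          ∑ n ∈ Finset.range (x + 1), (y : ℂ) ^ (∑ i, ArithmeticFunction.cardFactors (((f i).eval (n : ℤ)).toNat)))
          Filter.atTop (nhds (Λ y * Complex.exp (((y : ℂ) - 1) *
          (Real.log (∏ i, ((f i).natDegree : ℝ)) : ℂ)) * (Complex.Gamma y)⁻¹ ^ k)) := by
  intro k f hf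
  refine ⟨eulerFactor f, (eulerFactorClause_holds hf).1, (eulerFactorClause_holds hf).2, fun y hy hy' => ?_⟩
  exact segmentLaw_of_halves (stub_typeI k f hf y (by linarith) (by linarith))
    (kernelLaw_of_parts hT2 hRows hRec hHigh hf hy hy')

/-- **Uniqueness check against the landed Negative lemma** `Negative.Structure.omegaLaw_Λ_unique`: under the
stubs' statements, ANY `Λ` holomorphic on the ball satisfying the crux's segment law for a Bateman–Horn `f`
coincides with `eulerFactor f` on `|z| < 2` — the line produces exactly the function the identity theorem pins. -/
theorem eulerFactor_unique_of_parts
    (hT2 : ∀ (k : ℕ) (f : Fin k → ℤ[X]), IsBatemanHornSystem f → (∑ i, (f i).natDegree) = 2 → ∀ y : ℝ, 1 ≤ y → y < 2 →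
      APrioriBound k f y ∧ RankinTail k f y ∧ TopClassBound k f y ∧ BalancedClassBound k f y)
    (hRows : ∀ (k : ℕ) (f : Fin k → ℤ[X]), IsBatemanHornSystem f → (∑ i, (f i).natDegree) = 2 → CheapRowsUnit k f)
    (hRec : ∀ (k : ℕ) (f : Fin k → ℤ[X]), IsBatemanHornSystem f → (∑ i, (f i).natDegree) = 2 →
      (∀ y : ℝ, 1 < y → y < 2 → TypeILawOmega k f y) → CheapRowsUnit k f →
      (∀ y : ℝ, 1 ≤ y → y < 2 →
        APrioriBound k f y ∧ RankinTail k f y ∧ TopClassBound k f y ∧ BalancedClassBound k f y) →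
      ∀ y : ℝ, 5 / 4 < y → y < 7 / 4 → KernelLawOmega k f y)
    (hHigh : ∀ (k : ℕ) (f : Fin k → ℤ[X]), IsBatemanHornSystem f → 3 ≤ (∑ i, (f i).natDegree) →
      ∀ y : ℝ, 5 / 4 < y → y < 7 / 4 → KernelLawOmega k f y)
    {k : ℕ} {f : Fin k → ℤ[X]} (hf : IsBatemanHornSystem f) {Λ : ℂ → ℂ}
    (hΛ : DifferentiableOn ℂ Λ (Metric.ball 0 2))
    (hlaw : ∀ y : ℝ, 5 / 4 < y → y < 7 / 4 →
      Tendsto (fun x : ℕ => (x : ℂ)⁻¹ * Complex.exp ((k : ℂ) * (1 - (y : ℂ)) * (Real.log (Real.log x) : ℂ)) *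
          ∑ n ∈ Finset.range (x + 1), (y : ℂ) ^ (∑ i, cardFactors (((f i).eval (n : ℤ)).toNat))) atTop
        (𝓝 (Λ y * Complex.exp (((y : ℂ) - 1) * (Real.log (∏ i, ((f i).natDegree : ℝ)) : ℂ)) *
          (Complex.Gamma y)⁻¹ ^ k))) :
    Set.EqOn Λ (eulerFactor f) (Metric.ball 0 2) := by
  refine Summit.Parity.BatemanHorn.Theorems.LSDRealSegment.Negative.omegaLaw_Λ_unique (k := k) (f := f) hΛ
    (stub_eulerFactor k f hf) (fun y hy hy' => ?_) (fun y hy hy' => ?_)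
  · simpa only [mul_assoc] using hlaw y hy hy'
  · simpa only [mul_assoc] using segmentLaw_of_halves (stub_typeI k f hf y (by linarith) (by linarith))
      (kernelLaw_of_parts hT2 hRows hRec hHigh hf hy hy')

/-- **No-spike check against the landed Negative lemma** `Negative.NoSpikes` (triage F0): the line's law forces the
single normalised term `x⁻¹(log x)^{k(1−y)} y^{Ω_f(x)} → 0` — the Diophantine content (Ridout/BEG) that `stub_tailsTwo`
(through `BugeaudEvertseGyory2018_SPartPolynomialValues`) and the open stubs must and do carry. -/
theorem noSpike_of_parts
    (hT2 : ∀ (k : ℕ) (f : Fin k → ℤ[X]), IsBatemanHornSystem f → (∑ i, (f i).natDegree) = 2 → ∀ y : ℝ, 1 ≤ y → y < 2 →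
      APrioriBound k f y ∧ RankinTail k f y ∧ TopClassBound k f y ∧ BalancedClassBound k f y)
    (hRows : ∀ (k : ℕ) (f : Fin k → ℤ[X]), IsBatemanHornSystem f → (∑ i, (f i).natDegree) = 2 → CheapRowsUnit k f)
    (hRec : ∀ (k : ℕ) (f : Fin k → ℤ[X]), IsBatemanHornSystem f → (∑ i, (f i).natDegree) = 2 →
      (∀ y : ℝ, 1 < y → y < 2 → TypeILawOmega k f y) → CheapRowsUnit k f →
      (∀ y : ℝ, 1 ≤ y → y < 2 →
        APrioriBound k f y ∧ RankinTail k f y ∧ TopClassBound k f y ∧ BalancedClassBound k f y) →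
      ∀ y : ℝ, 5 / 4 < y → y < 7 / 4 → KernelLawOmega k f y)
    (hHigh : ∀ (k : ℕ) (f : Fin k → ℤ[X]), IsBatemanHornSystem f → 3 ≤ (∑ i, (f i).natDegree) →
      ∀ y : ℝ, 5 / 4 < y → y < 7 / 4 → KernelLawOmega k f y)
    {k : ℕ} {f : Fin k → ℤ[X]} (hf : IsBatemanHornSystem f) {y : ℝ} (hy : 5 / 4 < y) (hy' : y < 7 / 4) :
    Tendsto (fun x : ℕ => (x : ℂ)⁻¹ * Complex.exp ((k : ℂ) * (1 - (y : ℂ)) * (Real.log (Real.log x) : ℂ)) *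
      (y : ℂ) ^ (∑ i, cardFactors (((f i).eval (x : ℤ)).toNat))) atTop (𝓝 0) := by
  have hlaw := segmentLaw_of_halves (stub_typeI k f hf y (by linarith) (by linarith))
    (kernelLaw_of_parts hT2 hRows hRec hHigh hf hy hy')
  have := Summit.Parity.BatemanHorn.Theorems.LSDRealSegment.Negative.omegaLaw_tendsto_lastTerm_zero
    (fun n => ∑ i, cardFactors (((f i).eval (n : ℤ)).toNat)) ((k : ℂ) * (1 - (y : ℂ))) (y : ℂ) _
    (by simpa only [mul_assoc] using hlaw)
  simpa only [mul_assoc] using this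

/-- **The skeleton theorem**: the crux BY NAME from the four registered stubs (rev L3) and the landed theorems. -/
theorem LSDRealSegment_of : LSDRealSegment :=
  lsdRealSegment_of_parts stub_tailsTwo stub_cheapRowsTwo stub_reconstructionTwo stub_kernelHigh

end

end Summit.Parity.BatemanHorn.Cruxes.LSDRealSegment.ProductAnatomySubcritical
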